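import Literature.NumberTheory.EllipticCurves.HeegnerPointsOfConductor
import HarnessLib

/-!
# The genus datum at conductor `p`: `√p* ∈ K[p]`, moved by `Gal(K[p]/K)` through a sign character

Topic `NumberTheory/EllipticCurves` (class field theory of imaginary quadratic fields; vocabulary of
`HeegnerPointsOfConductor.lean`: the ring class field `K[n] = ringClassField K ι n ⊂ ℂ` realised by
singular moduli, its Galois group `ringClassGal ι n`).  Work item `wi-73261` (consumer: door-c3 (L2),
`Summit.BirchSwinnertonDyer…SchneiderFreeAdditiveX3BranchIMCRebaseGenus`, carried hypothesis «genus datum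
`θ ∈ K[p]`, `θ² = p*`, `σθ = χ(σ)θ`»).

* `Cox2013_sqrt_pStar_mem_ringClassField` — NAMED FACT (classical class field theory, free of RH and of BSD): for
  `K` imaginary quadratic, `p` an odd prime unramified in `K` and `p* = (−1)^{(p−1)/2} p`, every complex
  square root of `p*` lies in the ring class field `K[p]` of conductor `p`.  Printed ingredients (Cox,
  *Primes of the form x² + ny²*, 2nd ed. 2013): `K(√p*)/K` is abelian and Galois over `ℚ` with group
  `(ℤ/2)²`, hence generalized dihedral over `ℚ`, so it lies in a ring class field (Thm. 9.18); the
  conductor-`p` sharpening is the kernel comparison of Cor. 8.7 for the modulus `p𝒪_K` — the ring class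
  field of the order `𝒪_p = ℤ + p𝒪_K` is the class field of `P_{K,ℤ}(p)` (§9.A with Prop. 7.22), and
  for `α ≡ c (mod p𝒪_K)`, `c ∈ ℤ` prime to `p`, the Artin symbol of `(α)` acts on `√p*` by the genus
  character `(p*/N(α)) = (p*/c²) = 1` (Lemma 1.14 / Thm. 6.1: `(p*/·)` is a character modulo `p`) —
  read in the tree's realisation `K[p] = K(j(𝒪_p)-conjugates)` through Thm. 11.1.
* `genusDatum_of_sqrt_pStar_mem` — PROVED from the fact by pure algebra: the consumer's shape
  `∃ θ : K[p], ∃ s : Gal(K[p]/K) →* ℤˣ, θ² = p* ∧ θ ≠ 0 ∧ ∀ σ, σθ = s(σ)·θ` (`σθ = ±θ` because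
  `(σθ)² = p*` in a field; the sign is multiplicative).
WHAT THIS IS NOT: any statement about elliptic curves, `L`-functions or BSD; nothing here bears on BSD.
-/

noncomputable section

open scoped Classical

namespace Literature.NumberTheory.EllipticCurves

/-- **Genus datum at conductor `p` (named fact).**  Let `K` be an imaginary quadratic field, `ι : K → ℂ`
an embedding, `p` an odd prime unramified in `K` (`p ∤ d_K`), and `p* = (−1)^{(p−1)/2}·p`.  Then every
`θ ∈ ℂ` with `θ² = p*` lies in the ring class field `K[p] = ringClassField K ι p` of conductor `p`.
(Cox 2013: `K(√p*) ⊂ K[p]` by Thm. 9.18 (an abelian extension of `K` that is generalized dihedral over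
`ℚ` lies in a ring class field — here `Gal(K(√p*)/ℚ) ≅ (ℤ/2)²`) sharpened to conductor `p` by Cor. 8.7
with §9.A/Prop. 7.22 (`K[p]` is the class field of `P_{K,ℤ}(p)`) and the genus character `(p*/N(·))`
of Thm. 6.1 / Lemma 1.14, which kills `P_{K,ℤ}(p)`; `K[p]` is realised by singular moduli via Thm. 11.1.)
[cite: Cox2013, Thm. 9.18 (with Cor. 8.7, Prop. 7.22, §9.A, Thm. 6.1, Thm. 11.1)] -/
def Cox2013_sqrt_pStar_mem_ringClassField : Prop :=
  ∀ (K : Type) [Field K] [NumberField K], IsImaginaryQuadratic K → ∀ (ι : K →+* ℂ) (p : ℕ),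
    p.Prime → p ≠ 2 → ¬ ((p : ℤ) ∣ NumberField.discr K) →
      ∀ θ : ℂ, θ ^ 2 = (-1 : ℂ) ^ (p / 2) * (p : ℂ) → θ ∈ ringClassField K ι p

variable {K : Type} [Field K] [NumberField K]

/-- In a field of characteristic zero, a scaling `θ ↦ u·θ` by a unit `u ∈ ℤˣ = {±1}` of a non-zero `θ`
determines `u`. [folklore] -/
private theorem units_int_eq_of_mul_eq {L : Type*} [Field L] [CharZero L] {θ : L} (hθ : θ ≠ 0)
    {u v : ℤˣ} (h : ((u : ℤ) : L) * θ = ((v : ℤ) : L) * θ) : u = v := by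
  have h1 : ((u : ℤ) : L) = ((v : ℤ) : L) := mul_right_cancel₀ hθ h
  exact Units.ext (Int.cast_injective h1)

/-- **The genus datum in the consumer's shape** (door-c3 (L2)): from the named fact, for `K` imaginary
quadratic, `ι : K → ℂ`, `p` an odd prime unramified in `K`, there are `θ ∈ K[p]` and a character
`s : Gal(K[p]/K) → ℤˣ` with `θ² = p*`, `θ ≠ 0` and `σθ = s(σ)·θ` for all `σ ∈ Gal(K[p]/K)` (`s` is the
restriction to `K(√p*)`, i.e. the quadratic character of `√p*`).  PROVED (pure algebra over the fact).
[cite: Cox2013, Thm. 9.18 (with Cor. 8.7, Prop. 7.22, §9.A, Thm. 6.1, Thm. 11.1)] -/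
theorem genusDatum_of_sqrt_pStar_mem (h : Cox2013_sqrt_pStar_mem_ringClassField)
    (hK : IsImaginaryQuadratic K) (ι : K →+* ℂ) {p : ℕ} (hp : p.Prime) (hp2 : p ≠ 2)
    (hpd : ¬ ((p : ℤ) ∣ NumberField.discr K)) :
    ∃ (θ : ringClassField K ι p) (s : ringClassGal ι p →* ℤˣ),
      θ ^ 2 = algebraMap ℚ (ringClassField K ι p) ((-1 : ℚ) ^ (p / 2) * p) ∧ θ ≠ 0 ∧
      ∀ σ : ringClassGal ι p, σ.1 θ = ((s σ : ℤ) : ringClassField K ι p) * θ := by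
  obtain ⟨θ₀, hθ₀⟩ := IsAlgClosed.exists_pow_nat_eq ((-1 : ℂ) ^ (p / 2) * (p : ℂ)) two_pos
  have hmem : θ₀ ∈ ringClassField K ι p := h K hK ι p hp hp2 hpd θ₀ hθ₀
  set L := ringClassField K ι p with hL
  -- the element and its square
  set θ : L := ⟨θ₀, hmem⟩ with hθ_def
  have hq : (algebraMap ℚ L ((-1 : ℚ) ^ (p / 2) * p) : ℂ) = (-1 : ℂ) ^ (p / 2) * (p : ℂ) := by
    rw [eq_ratCast, SubfieldClass.coe_ratCast]
    push_cast
    rfl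
  have hθsq : θ ^ 2 = algebraMap ℚ L ((-1 : ℚ) ^ (p / 2) * p) := by
    apply Subtype.ext
    rw [SubmonoidClass.coe_pow, hq]
    exact hθ₀
  have hθ0 : θ ≠ 0 := by
    intro h0
    have h0' : θ₀ = 0 := by simpa [hθ_def] using congrArg Subtype.val h0
    have : (-1 : ℂ) ^ (p / 2) * (p : ℂ) = 0 := by rw [← hθ₀, h0']; norm_num
    have hp0 : (p : ℂ) ≠ 0 := by exact_mod_cast hp.ne_zero
    exact hp0 ((mul_eq_zero.1 this).resolve_left (pow_ne_zero _ (by norm_num)))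
  -- every `ℚ`-automorphism moves `θ` to `±θ`
  have hsq : ∀ σ : L ≃ₐ[ℚ] L, σ θ = θ ∨ σ θ = -θ := by
    intro σ
    have h2 : (σ θ) ^ 2 = θ ^ 2 := by
      rw [← map_pow, hθsq, AlgEquiv.commutes]
    exact sq_eq_sq_iff_eq_or_eq_neg.1 h2
  -- the sign, as a function on all of `Aut_ℚ(K[p])`
  set ε : (L ≃ₐ[ℚ] L) → ℤˣ := fun σ ↦ if σ θ = θ then 1 else -1 with hε_def
  have hε : ∀ σ : L ≃ₐ[ℚ] L, σ θ = ((ε σ : ℤ) : L) * θ := by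
    intro σ
    rcases hsq σ with h1 | h1
    · simp [hε_def, h1]
    · have hne : (-θ : L) ≠ θ := by
        intro h3
        have : (2 : L) * θ = 0 := by linear_combination (-1 : L) * h3
        exact hθ0 ((mul_eq_zero.1 this).resolve_left two_ne_zero)
      simp [hε_def, h1, hne]
  have hmul : ∀ σ τ : L ≃ₐ[ℚ] L, ε (σ * τ) = ε σ * ε τ := by
    intro σ τ
    apply units_int_eq_of_mul_eq hθ0
    rw [← hε (σ * τ), AlgEquiv.mul_apply, hε τ, map_mul, map_intCast, hε σ, Units.val_mul,
      Int.cast_mul]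
    ring
  refine ⟨θ, (MonoidHom.mk' ε hmul).comp (ringClassGal ι p).subtype, hθsq, hθ0, fun σ ↦ ?_⟩
  simpa using hε σ.1

end Literature.NumberTheory.EllipticCurves

end
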